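import Literature.Barriers.ResolutionOfSingularities.LocalMonomializationFails
import Literature.AlgebraicGeometry.Resolution.OriginLocalRing
import HarnessLib

/-!
# Monomial forms persist along quadratic transforms of the source (Cutkosky §3)

`Literature/Barriers/ResolutionOfSingularities/LocalMonomializationFailsPersist.lean` — the one
sentence of the proof of Theorem 1.4 in Cutkosky's paper that is used without proof there:

> "If `A_i → B_l` is monomial, and `A_i → A_j` is a sequence of quadratic transforms which are
> dominated by `B_l`, then `A_j → B_l` is also monomial; we thus reduce to consideration of
> monomialization within the diagrams `B_{pi} → ⋯ → B_{p(i+1)−1} ← A_{pi}`."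
> [cite: Cutkosky2014, §3 (p. 7)]

It is vendored here as a NAMED FACT for exactly the rings that occur in §3 — one quadratic
transform `A_i = F[P,Q]_{(P,Q)} → A_{i+1} = F[Q, P/Q − γ]_{(Q, P/Q−γ)}` at an `F`-rational point
of the exceptional line (the printed steps `u = u₁v₁`, …, `u = u_pᵖ(v_p + β), v = u_p` are all of
this form up to the order of the coordinates), and `B_l = F[z]_{(z)}` a two-dimensional regular
algebraic local ring with residue field `F` (`originLocalRing`) containing and dominating
`A_{i+1}` — so that it is a special case of the printed sentence (sequences: iterate). This is
the fourth named sub-fact of the decomposition of the XL discharge of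
`Literature.Barriers.ResolutionOfSingularities.Cutkosky.Cutkosky2014`; its own discharge is
elementary (sketch: `𝔪_{A_i} B_l = Q·B_l` is principal, so `Q` is a unit multiple of the smaller
of the two monomials `y^{r₁}, y^{r₂}` of the monomial form, say `y^{r₁}`, and `r₁ ≤ r₂`; then
`x₁/Q` is a unit and `x₂/Q ≡ a₂·(P/Q − γ)` modulo `Q` in `A_{i+1}` with `a₂ ≠ 0`, so
`(Q, x₂/Q)` is a regular system of parameters of `A_{i+1}` of monomial form `(ε y^{r₁},
ε' y^{r₂ − r₁})`, with the same determinant) and is a later target.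
-/

noncomputable section

namespace Literature.Barriers.ResolutionOfSingularities

namespace Cutkosky

open Literature.AlgebraicGeometry.Resolution

universe u

/-- NAMED FACT — **monomial forms persist under a quadratic transform of the source dominated by
the target** (Cutkosky, §3, p. 7: "If `A_i → B_l` is monomial, and `A_i → A_j` is a sequence of
quadratic transforms which are dominated by `B_l`, then `A_j → B_l` is also monomial"), for the
rings of §3: `A = F[P,Q]_{(P,Q)}`, its quadratic transform `A₁ = F[Q, P/Q − γ]_{(Q, P/Q − γ)}`
(`γ ∈ F`), and `S = F[z₁,z₂]_{(z₁,z₂)}` with `A₁ ⊆ S` dominated by `S`: if `A → S` is monomial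
(Def. 1.1, `IsMonomialExtension`, for the inclusion) then so is `A₁ → S`. Users take
`(h : CutkoskyMonomialPersists)`. [cite: Cutkosky2014, §3 (p. 7)] -/
def CutkoskyMonomialPersists : Prop :=
  ∀ (F : Type u) [Field F] (L : Type u) [Field L] [Algebra F L]
    (P Q : L) (hPQ : AlgebraicIndependent F ![P, Q]) (γ : F)
    (h' : AlgebraicIndependent F ![Q, P / Q - algebraMap F L γ])
    (z : Fin 2 → L) (hz : AlgebraicIndependent F z)
    (h₁ : originLocalRing h' ≤ originLocalRing hz),
    Dominates F L (originLocalRing h') (originLocalRing hz) →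
  ∀ (h₀ : originLocalRing hPQ ≤ originLocalRing hz),
    @IsMonomialExtension (originLocalRing hPQ) (originLocalRing hz) _ _ (inclusionAlgebra h₀) →
    @IsMonomialExtension (originLocalRing h') (originLocalRing hz) _ _ (inclusionAlgebra h₁)

end Cutkosky

end Literature.Barriers.ResolutionOfSingularities

end
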